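import Literature.Probability.Percolation.ZdFourArmSepOutwardScheme
import HarnessLib

/-!
# Kesten's arm separation for four arms of bond percolation on `ℤ²` from two good events and two landings

Topic `Literature/Probability/Percolation`; critical bond percolation on `ℤ²`
(`P = P_{1/2} = bondPercolation (zdGraph 2) half`). PROOFS ONLY (no definition, no named fact).

The two surgery-and-landing inputs `hout`, `hin` of `zdFourArm_wellSeparated_of_outIn`
(`ZdFourArmSepOutwardScheme.lean`) each consist of a STEP with a prescribed failure rate `ε` and
a LANDING at constant cost. P. Nolin, EJP 13 (2008), §4.4, proof of Thm. 11 (arXiv 0711.4948: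
Thm. 10, pp. 12–13) obtains the step "by independence of the two latter events" from a failure
event of probability `≤ 4δ ≤ ε` read in the annulus where the surgery takes place
(`A_{j,σ}(2^k, 2^K) ⊆ Ã(2^k, 2^K) ∪ ({one of the four U fails} ∩ A_{j,σ}(2^k, 2^{K-1}))`). This
file performs that reduction once and for all on bond-`ℤ²` (the tree's
`real_fourArmTwoClusters_le_add_mul` for the outer step, `real_zdFourArmOutLanded_le_add_mul_inner`
for the inner step), so that the two pattern-specific cores only have to deliver, for every
`ε > 0`:

* OUTER (`zdFourArm_hout_of_goodEvents`): bad events `Bad M` read OFF `B(M)` (determined by a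
  finite set of pairs each with a vertex outside `box 2 M`) with `P(Bad M) ≤ ε` for `M ≥ n₁`, and
  ONE landing inequality `P(fourArmTwoClusters n (2M) ∖ Bad M) ≤ C₁ · P(zdFourArmOutLanded n (4M))`
  (`n₁ ≤ n ≤ M`);
* INNER (`zdFourArm_hin_of_goodEvents`): bad events `Bad m` read INSIDE `B(2m - 1)` with
  `P(Bad m) ≤ ε` for `m ≥ n₁`, and ONE landing inequality
  `P(zdFourArmOutLanded (2m) N ∖ Bad (2m)) ≤ C₁ · P(zdFourArmSep m N)` (`n₁ ≤ m`, `4m ≤ N`);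

and `zdFourArm_wellSeparated_of_goodEvents`,
`DuminilCopinManolescuTassion2021_zdFourArm_quasiMult_of_goodEvents`,
`Nolin2008_zdEdgeFourArmQuasiMult_of_goodEvents` conclude.

## References

* P. Nolin, *Near-critical percolation in two dimensions*, EJP 13 (2008), §4.4, proof of Thm. 11
  (arXiv 0711.4948: Thm. 10, pp. 12–13) [Nolin2008].
* H. Kesten, *Scaling relations for 2D-percolation*, CMP 109 (1987), §2, Lemmas 4–5 [KestenScalingCMP1987].
* H. Duminil-Copin, I. Manolescu, V. Tassion, PTRF 181 (2021), §6.2 Prop. 6.2–6.3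
  [DuminilCopinManolescuTassion2021].
-/

noncomputable section

open MeasureTheory Set

namespace Literature.Probability.Percolation

open LatticeModels

/-- **The outer surgery-and-landing input from bad events off `B(M)` and one landing.** [cite: Nolin2008, §4.4, proof of Thm. 11, "by independence of the two latter events" (arXiv 0711.4948: Thm. 10, p. 12)] -/
theorem zdFourArm_hout_of_goodEvents
    (h : ∀ ε : ℝ, 0 < ε → ∃ (C₁ : ℝ) (n₁ : ℕ) (Bad : ℕ → Set (BondConfig (Site 2)))
        (T : ℕ → Finset (Sym2 (Site 2))), 0 ≤ C₁ ∧ (∀ M, DeterminedBy (Bad M) ↑(T M)) ∧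
      (∀ M, ∀ e ∈ T M, ∃ v ∈ e, v ∉ box 2 M) ∧
      (∀ M, n₁ ≤ M → (bondPercolation (zdGraph 2) half).real (Bad M) ≤ ε) ∧
      (∀ n M : ℕ, n₁ ≤ n → n ≤ M →
        (bondPercolation (zdGraph 2) half).real (fourArmTwoClusters n (2 * M) \ Bad M) ≤
          C₁ * (bondPercolation (zdGraph 2) half).real (zdFourArmOutLanded n (4 * M)))) :
    ∀ ε : ℝ, 0 < ε → ∃ (C₁ : ℝ) (n₁ : ℕ) (G : ℕ → ℕ → Set (BondConfig (Site 2))), 0 ≤ C₁ ∧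
      (∀ n M : ℕ, n₁ ≤ n → n ≤ M →
        (bondPercolation (zdGraph 2) half).real (fourArmTwoClusters n (2 * M)) ≤
          (bondPercolation (zdGraph 2) half).real (G n (2 * M)) +
            ε * (bondPercolation (zdGraph 2) half).real (fourArmTwoClusters n M)) ∧
      (∀ n M : ℕ, n₁ ≤ n → 2 * n ≤ M →
        (bondPercolation (zdGraph 2) half).real (G n M) ≤
          C₁ * (bondPercolation (zdGraph 2) half).real (zdFourArmOutLanded n (2 * M))) := by
  intro ε hε
  obtain ⟨C₁, n₁, Bad, T, hC₁, hdet, hT, hsmall, hland⟩ := h ε hε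
  refine ⟨C₁, n₁, fun n M => if M % 2 = 0 then fourArmTwoClusters n M \ Bad (M / 2) else ∅, hC₁,
    fun n M hn hM => ?_, fun n M hn hM => ?_⟩
  · have hG : (if (2 * M) % 2 = 0 then fourArmTwoClusters n (2 * M) \ Bad (2 * M / 2) else ∅) =
        fourArmTwoClusters n (2 * M) \ Bad M := by
      rw [if_pos (Nat.mul_mod_right 2 M), Nat.mul_div_cancel_left M (by norm_num)]
    beta_reduce
    rw [hG]
    calc (bondPercolation (zdGraph 2) half).real (fourArmTwoClusters n (2 * M))
        ≤ (bondPercolation (zdGraph 2) half).real (fourArmTwoClusters n (2 * M) \ Bad M) +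
            (bondPercolation (zdGraph 2) half).real (Bad M) *
              (bondPercolation (zdGraph 2) half).real (fourArmTwoClusters n M) :=
          real_fourArmTwoClusters_le_add_mul half hM (by omega) subset_rfl (hdet M) (hT M)
      _ ≤ _ := by
          gcongr
          exact hsmall M (hn.trans hM)
  · beta_reduce
    by_cases hpar : M % 2 = 0
    · obtain ⟨M', rfl⟩ : ∃ M', M = 2 * M' := ⟨M / 2, by omega⟩
      have hG : (if (2 * M') % 2 = 0 then fourArmTwoClusters n (2 * M') \ Bad (2 * M' / 2) else ∅) =
          fourArmTwoClusters n (2 * M') \ Bad M' := by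
        rw [if_pos (Nat.mul_mod_right 2 M'), Nat.mul_div_cancel_left M' (by norm_num)]
      rw [hG, show 2 * (2 * M') = 4 * M' by ring]
      exact hland n M' hn (by omega)
    · rw [if_neg hpar, measureReal_empty]
      exact mul_nonneg hC₁ measureReal_nonneg

/-- **The inner surgery-and-landing input from bad events inside `B(2m-1)` and one landing.** [cite: Nolin2008, §4.4, proof of Thm. 11, internal extremities (arXiv 0711.4948: Thm. 10, pp. 12–13)] [cite: KestenScalingCMP1987, §2 Lemma 5] -/
theorem zdFourArm_hin_of_goodEvents
    (h : ∀ ε : ℝ, 0 < ε → ∃ (C₁ : ℝ) (n₁ : ℕ) (Bad : ℕ → Set (BondConfig (Site 2)))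
        (T : ℕ → Finset (Sym2 (Site 2))), 0 ≤ C₁ ∧ (∀ m, DeterminedBy (Bad m) ↑(T m)) ∧
      (∀ m, ∀ e ∈ T m, ∃ v ∈ e, v ∈ box 2 (2 * m - 1)) ∧
      (∀ m, n₁ ≤ m → (bondPercolation (zdGraph 2) half).real (Bad m) ≤ ε) ∧
      (∀ m N : ℕ, n₁ ≤ m → 4 * m ≤ N →
        (bondPercolation (zdGraph 2) half).real (zdFourArmOutLanded (2 * m) N \ Bad (2 * m)) ≤
          C₁ * (bondPercolation (zdGraph 2) half).real (zdFourArmSep m N))) :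
    ∀ ε : ℝ, 0 < ε → ∃ (C₁ : ℝ) (n₁ : ℕ) (G : ℕ → ℕ → Set (BondConfig (Site 2))), 0 ≤ C₁ ∧
      (∀ m N : ℕ, n₁ ≤ m → 4 * m ≤ N →
        (bondPercolation (zdGraph 2) half).real (zdFourArmOutLanded m N) ≤
          (bondPercolation (zdGraph 2) half).real (G m N) +
            ε * (bondPercolation (zdGraph 2) half).real (zdFourArmOutLanded (2 * m) N)) ∧
      (∀ m N : ℕ, n₁ ≤ m → 4 * m ≤ N →
        (bondPercolation (zdGraph 2) half).real (G (2 * m) N) ≤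
          C₁ * (bondPercolation (zdGraph 2) half).real (zdFourArmSep m N)) := by
  intro ε hε
  obtain ⟨C₁, n₁, Bad, T, hC₁, hdet, hT, hsmall, hland⟩ := h ε hε
  refine ⟨C₁, max n₁ 1, fun m N => zdFourArmOutLanded m N \ Bad m, hC₁, fun m N hm h4 => ?_,
    fun m N hm h4 => hland m N (le_of_max_le_left hm) h4⟩
  have hm1 : 1 ≤ m := le_of_max_le_right hm
  calc (bondPercolation (zdGraph 2) half).real (zdFourArmOutLanded m N)
      ≤ (bondPercolation (zdGraph 2) half).real (zdFourArmOutLanded m N \ Bad m) +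
          (bondPercolation (zdGraph 2) half).real (Bad m) *
            (bondPercolation (zdGraph 2) half).real (zdFourArmOutLanded (2 * m) N) :=
        real_zdFourArmOutLanded_le_add_mul_inner half hm1 h4 subset_rfl (hdet m)
          ((hdet m).measurableSet_of_finset) (fun e he => hT m e (Finset.mem_coe.1 he))
    _ ≤ _ := by
        gcongr
        exact hsmall m (le_of_max_le_left hm)

/-- **Kesten's arm-separation display for four arms of bond percolation on `ℤ²` from two good
events and two landings.** [cite: Nolin2008, §4.4 Thm. 11 (arXiv 0711.4948: Thm. 10)] [cite: KestenScalingCMP1987, §2 Lemmas 4–5] -/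
theorem zdFourArm_wellSeparated_of_goodEvents
    (hout : ∀ ε : ℝ, 0 < ε → ∃ (C₁ : ℝ) (n₁ : ℕ) (Bad : ℕ → Set (BondConfig (Site 2)))
        (T : ℕ → Finset (Sym2 (Site 2))), 0 ≤ C₁ ∧ (∀ M, DeterminedBy (Bad M) ↑(T M)) ∧
      (∀ M, ∀ e ∈ T M, ∃ v ∈ e, v ∉ box 2 M) ∧
      (∀ M, n₁ ≤ M → (bondPercolation (zdGraph 2) half).real (Bad M) ≤ ε) ∧
      (∀ n M : ℕ, n₁ ≤ n → n ≤ M →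
        (bondPercolation (zdGraph 2) half).real (fourArmTwoClusters n (2 * M) \ Bad M) ≤
          C₁ * (bondPercolation (zdGraph 2) half).real (zdFourArmOutLanded n (4 * M))))
    (hin : ∀ ε : ℝ, 0 < ε → ∃ (C₁ : ℝ) (n₁ : ℕ) (Bad : ℕ → Set (BondConfig (Site 2)))
        (T : ℕ → Finset (Sym2 (Site 2))), 0 ≤ C₁ ∧ (∀ m, DeterminedBy (Bad m) ↑(T m)) ∧
      (∀ m, ∀ e ∈ T m, ∃ v ∈ e, v ∈ box 2 (2 * m - 1)) ∧
      (∀ m, n₁ ≤ m → (bondPercolation (zdGraph 2) half).real (Bad m) ≤ ε) ∧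
      (∀ m N : ℕ, n₁ ≤ m → 4 * m ≤ N →
        (bondPercolation (zdGraph 2) half).real (zdFourArmOutLanded (2 * m) N \ Bad (2 * m)) ≤
          C₁ * (bondPercolation (zdGraph 2) half).real (zdFourArmSep m N))) :
    ∃ n₀ : ℕ, ∃ c : ℝ, 0 < c ∧ ∀ n N : ℕ, n₀ ≤ n → 2 * n ≤ N →
      c * (bondPercolation (zdGraph 2) half).real (fourArmTwoClusters n N) ≤
        (bondPercolation (zdGraph 2) half).real (zdFourArmSep n N) :=
  zdFourArm_wellSeparated_of_outIn (zdFourArm_hout_of_goodEvents hout) (zdFourArm_hin_of_goodEvents hin)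

/-- **DMT 2021, Prop. 6.3 for `q = 1` on `ℤ²` (cluster form) from two good events and two
landings.** [cite: DuminilCopinManolescuTassion2021, §6.2 Prop. 6.3 (right inequality), q = 1, σ = 1010] -/
theorem DuminilCopinManolescuTassion2021_zdFourArm_quasiMult_of_goodEvents
    (hout : ∀ ε : ℝ, 0 < ε → ∃ (C₁ : ℝ) (n₁ : ℕ) (Bad : ℕ → Set (BondConfig (Site 2)))
        (T : ℕ → Finset (Sym2 (Site 2))), 0 ≤ C₁ ∧ (∀ M, DeterminedBy (Bad M) ↑(T M)) ∧
      (∀ M, ∀ e ∈ T M, ∃ v ∈ e, v ∉ box 2 M) ∧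
      (∀ M, n₁ ≤ M → (bondPercolation (zdGraph 2) half).real (Bad M) ≤ ε) ∧
      (∀ n M : ℕ, n₁ ≤ n → n ≤ M →
        (bondPercolation (zdGraph 2) half).real (fourArmTwoClusters n (2 * M) \ Bad M) ≤
          C₁ * (bondPercolation (zdGraph 2) half).real (zdFourArmOutLanded n (4 * M))))
    (hin : ∀ ε : ℝ, 0 < ε → ∃ (C₁ : ℝ) (n₁ : ℕ) (Bad : ℕ → Set (BondConfig (Site 2)))
        (T : ℕ → Finset (Sym2 (Site 2))), 0 ≤ C₁ ∧ (∀ m, DeterminedBy (Bad m) ↑(T m)) ∧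
      (∀ m, ∀ e ∈ T m, ∃ v ∈ e, v ∈ box 2 (2 * m - 1)) ∧
      (∀ m, n₁ ≤ m → (bondPercolation (zdGraph 2) half).real (Bad m) ≤ ε) ∧
      (∀ m N : ℕ, n₁ ≤ m → 4 * m ≤ N →
        (bondPercolation (zdGraph 2) half).real (zdFourArmOutLanded (2 * m) N \ Bad (2 * m)) ≤
          C₁ * (bondPercolation (zdGraph 2) half).real (zdFourArmSep m N))) :
    DuminilCopinManolescuTassion2021_zdFourArm_quasiMult :=
  DuminilCopinManolescuTassion2021_zdFourArm_quasiMult_of_wellSeparated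
    (zdFourArm_wellSeparated_of_goodEvents hout hin)

/-- **Nolin 2008, Prop. 17 for the single-bond four-arm event on `ℤ²` from two good events and two
landings.** [cite: Nolin2008, §4.1 and §4.5 Prop. 17 (arXiv 0711.4948: Prop. 16)] -/
theorem Nolin2008_zdEdgeFourArmQuasiMult_of_goodEvents
    (hout : ∀ ε : ℝ, 0 < ε → ∃ (C₁ : ℝ) (n₁ : ℕ) (Bad : ℕ → Set (BondConfig (Site 2)))
        (T : ℕ → Finset (Sym2 (Site 2))), 0 ≤ C₁ ∧ (∀ M, DeterminedBy (Bad M) ↑(T M)) ∧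
      (∀ M, ∀ e ∈ T M, ∃ v ∈ e, v ∉ box 2 M) ∧
      (∀ M, n₁ ≤ M → (bondPercolation (zdGraph 2) half).real (Bad M) ≤ ε) ∧
      (∀ n M : ℕ, n₁ ≤ n → n ≤ M →
        (bondPercolation (zdGraph 2) half).real (fourArmTwoClusters n (2 * M) \ Bad M) ≤
          C₁ * (bondPercolation (zdGraph 2) half).real (zdFourArmOutLanded n (4 * M))))
    (hin : ∀ ε : ℝ, 0 < ε → ∃ (C₁ : ℝ) (n₁ : ℕ) (Bad : ℕ → Set (BondConfig (Site 2)))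
        (T : ℕ → Finset (Sym2 (Site 2))), 0 ≤ C₁ ∧ (∀ m, DeterminedBy (Bad m) ↑(T m)) ∧
      (∀ m, ∀ e ∈ T m, ∃ v ∈ e, v ∈ box 2 (2 * m - 1)) ∧
      (∀ m, n₁ ≤ m → (bondPercolation (zdGraph 2) half).real (Bad m) ≤ ε) ∧
      (∀ m N : ℕ, n₁ ≤ m → 4 * m ≤ N →
        (bondPercolation (zdGraph 2) half).real (zdFourArmOutLanded (2 * m) N \ Bad (2 * m)) ≤
          C₁ * (bondPercolation (zdGraph 2) half).real (zdFourArmSep m N))) :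
    Nolin2008_zdEdgeFourArmQuasiMult :=
  Nolin2008_zdEdgeFourArmQuasiMult_of_zdFourArm_wellSeparated (zdFourArm_wellSeparated_of_goodEvents hout hin)

end Literature.Probability.Percolation

end
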